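/-
Copyright (c) 2026 the pub-hodgecm-mathlib formalisation cell (harness21).  Prover seat hodgecm-mathlib-K2Liu-p08 (g6), Track B «K2-LIT»,
#184♮ = hLiu418 = `stmt-HodgeConjecture-24832`; #42S BLOCK D, row D-2, (σ-A) mini-road (LEAD F0P6-plan (g15) RULING M-160f ∕ BATCH #238; (σ-A) road desk
K2Liu-p25 (g3) WORD #15), brick (an-3b): THE FIBRE MASS OF THE KERNEL HYPERPLANE AND THE VERTEX SUMMATION (the `L¹` letter of the cone word's density).
THEOREMS ONLY (no `def`, no `instance`, no `notation`, no named-fact hypothesis, no `sorry`, default heartbeats).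
-/
import Summits.HodgeConjecture.HodgeConjecture.Theorems.K2LiuCornerZetaStageInversion   -- ★ p864380 (an-2): `integral_piFourierSB_comp_linear_eq` (the ζ-stage engine)
import Literature.NumberTheory.Weil1965.SplitPlaceSliceDensity                            -- ★ `SplitPlace.level`, `mem_shell_level`, `le_level_of_mem` (shells of `F^ι`)
import Mathlib.Analysis.SpecificLimits.Basic
import HarnessLib

/-!
# Crux `HLiu418`, #42S BLOCK D, row D-2, (σ-A) brick (an-3b): THE FIBRE MASS OF A BOX ON THE KERNEL HYPERPLANE, AND THE VERTEX SUMMATION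

Cell `hodgecm-mathlib`, crux item hLiu418 = `stmt-HodgeConjecture-24832` (helper lane `--supports … --as helper`, count-neutral; closes no socket); squad K2 ∕ K2Liu (L1).
Prover K2Liu-p08 (g6) = pen of [A4]∕(an-3) under the (σ-A) road desk K2Liu-p25 (g3).

THE POINT.  (an-3)'s cone word presents the stage-B value against the PRODUCT carrier `ρ = σ ⊗ μ^{ι₂}` (`σ` = (an-1)'s null-cone measure in the `s`-slot, `b` the fibre
coordinate of the adapted frame `A_s` of ★ (an-3a)), with density `G(s,b) = c·|det A_s|·Θ(A_s(0 ⊔ b) ⊔ s)`.  Its `L¹(ρ)` letter for ★ [A4-close] §4 needs the mass of the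
`b`-fibre to be `≍ ‖s‖^{−card κ}` near the vertex, summable against `σ`'s vertex law `σ(𝔭^n-box) ≍ q^{−(card ι₁ − 2) n}`.  THIS FILE supplies the two [A1]-free
facts, CHART-FREE (no minor, no selection function, enters the estimate):
* §1 **`fibreMass_box_eq`** — THE FIBRE MASS OF A BOX IS READ ON THE FOURIER SIDE: for any `Z`, any adapted frame `A` (★ (an-2)'s letter `hA`) and the box
  `B_N = (𝔭^N)^{ι₁}`:  **`c_κ · |det A| · μ^{ι₂}{b : A(0 ⊔ b) ∈ B_N} = μ^{ι₁}(B_N) · μ^κ{ζ : Z ζ ∈ B_{m−N}}`** — ★ p864380 `integral_piFourierSB_comp_linear_eq` at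
  `G := 1_{B_N}` (★ `piFourierSB_indicator_piPrimePowBall`: `𝓕 1_{B_N} = μ(B_N)·1_{B_{m−N}}`).  The left side is intrinsic (the Haar mass of `B_N ∩ ker Zᵀ` for the
  inversion-normalised measure), so is the right side: the `b`-fibre mass is the `ζ`-volume of `Z⁻¹(dual box)` — for `Z_s ζ = ζ·s` that volume is `≍ ‖s‖^{−card κ}`.
* §2 **`fibreMass_box_le`** — the bound form: if `Z ζ ∈ B_{m−N} → ζ ∈ (𝔭^{n₁})^κ` (a lower bound on `Z`), then
  `c_κ · |det A| · μ^{ι₂}{b : A(0 ⊔ b) ∈ B_N} ≤ μ^{ι₁}(B_N) · μ^κ((𝔭^{n₁})^κ)`.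
* §3 **`setLIntegral_le_of_shell_bound`** — VERTEX SUMMATION (any measure `σ` on `F^ι` with `σ{0} = 0`): a shell-wise bound `f ≤ C_f·r^k` on
  `(𝔭^{N₀+k})^ι ∖ (𝔭^{N₀+k+1})^ι` and a vertex mass law `σ((𝔭^{N₀+k})^ι) ≤ C_σ·ρ^k` give `∫⁻_{(𝔭^{N₀})^ι} f dσ ≤ C_f·C_σ·Σ_k (rρ)^k` (`< ∞` when `rρ < 1`:
  `…_lt_top_of_shell_bound`) — at use `r = q^{card κ}` (fibre mass), `ρ = q^{−(card ι₁ − 2)}` ((an-1)'s null-cone law), `card κ = 2 < 4`.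
* §4 **`integrable_prod_of_lintegral_fibre_le`** — TONELLI ASSEMBLY: `‖G(s,·)‖`'s fibre integrals bounded by `W s` with `∫⁻ W dσ < ∞` ⇒ `G ∈ L¹(σ ⊗ ν)`.
[WeilBNT1967, Chap. VII §2 Prop. 2, Cor. 1; Chap. I §2 Th. 3 Cor. 3] [KudlaRallis1994, §2 (2.10)–(2.12)] [Weil1965, Chap. III n° 37 Prop. 6].
HONEST LABEL.  Count-neutral helper; closes no socket; `HC_CM` is proved only modulo the 7 printed citations (2 remaining named inputs: hLiu418 =
`stmt-HodgeConjecture-24832`, h413 = `stmt-HodgeConjecture-24833`) until rung 0 closes.  NOT here: the concrete `Z_s`, the chart partition and the instantiation at (an-1)'s `σ` ((an-3c)).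

## References
* [WeilBNT1967] A. Weil, *Basic Number Theory* (1967), Chap. VII §2 Prop. 2 and Cor. 1 (transform of a box indicator; inversion constant), Chap. I §2 Th. 3 Cor. 3.
* [KudlaRallis1994] S. Kudla, S. Rallis, *A regularized Siegel–Weil formula: the first term identity*, Ann. of Math. 140 (1994), §2 (2.10)–(2.12).
* [Weil1965] A. Weil, *Sur la formule de Siegel dans la théorie des groupes classiques*, Acta Math. 113 (1965), Chap. III n° 37 Prop. 6 (integrability at the vertex).
-/

set_option autoImplicit false
set_option linter.dupNamespace false -- the mandated namespace repeats `HodgeConjecture.HodgeConjecture`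

noncomputable section

open MeasureTheory Set Filter
open scoped Matrix NNReal ENNReal Topology
open Literature.NumberTheory.Automorphic
open Literature.NumberTheory.GaloisRepresentations Literature.NumberTheory.GaloisRepresentations.IsNonarchimedeanLocalField
open Literature.RepresentationTheory.HeisenbergGroup
open Summit.HodgeConjecture.HodgeConjecture.Cruxes.HLiu418

namespace Summit.HodgeConjecture.HodgeConjecture.Cruxes.HLiu418.K2LiuConeVertexFubini

variable {F : Type*} [Field F] [ValuativeRel F] [TopologicalSpace F] [IsNonarchimedeanLocalField F]
  {κ ι₂ ι₁ : Type*} [Fintype κ] [Fintype ι₂] [Fintype ι₁] (eA : κ ⊕ ι₂ ≃ ι₁)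
  (Z : (κ → F) →ₗ[F] (ι₁ → F)) (A : (ι₁ → F) ≃ₗ[F] (ι₁ → F))
  [MeasurableSpace F] [BorelSpace F] (μ : Measure F) [μ.IsAddHaarMeasure]
  {ψ : AddChar F Circle} (hψ : ψ.IsContinuousNontrivial) {m : ℤ} (hm : ψ.HasConductorExp m)

/-! ## §1 The fibre mass of a box, read on the Fourier side -/

omit [MeasurableSpace F] [BorelSpace F] [Fintype ι₁] in
/-- the `ζ`-preimage of a box under the linear map `Z` is closed, hence measurable. [folklore] -/
theorem isClosed_preimage_piPrimePowBall (N : ℤ) : IsClosed {ζ : κ → F | Z ζ ∈ piPrimePowBall F ι₁ N} :=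
  (isClosed_piPrimePowBall N).preimage (LinearMap.continuous_on_pi Z)

omit [MeasurableSpace F] [BorelSpace F] [Fintype κ] [Fintype ι₂] in
/-- the `b`-preimage of a box under the fibre map `b ↦ A(0 ⊔ b)` is closed, hence measurable. [folklore] -/
theorem isClosed_preimage_frame_glue_piPrimePowBall (N : ℤ) :
    IsClosed {b : ι₂ → F | A (glue eA 0 b) ∈ piPrimePowBall F ι₁ N} := by
  have hc : Continuous fun b : ι₂ → F => A (glue eA (0 : κ → F) b) :=
    (LinearMap.continuous_on_pi (A : (ι₁ → F) →ₗ[F] (ι₁ → F))).comp ((continuous_glue eA).comp (continuous_const.prodMk continuous_id))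
  exact (isClosed_piPrimePowBall N).preimage hc

include hψ hm in
/-- **THE FIBRE MASS OF A BOX, READ ON THE FOURIER SIDE.**  `μ` Haar on `F`, `ψ` of conductor exponent `m`, `c_κ = piSelfDualConst F κ μ^κ m`; `Z : F^κ → F^{ι₁}`
linear, `A` an adapted frame (`A t ⬝ᵥ Z ζ = t|κ ⬝ᵥ ζ`, ★ (an-2)'s letter; ★ (an-3a) builds it from an invertible minor).  For every box `B_N = (𝔭^N)^{ι₁}`:
**`c_κ · |det A| · μ^{ι₂}{b : A(0 ⊔ b) ∈ B_N} = μ^{ι₁}(B_N) · μ^κ{ζ : Z ζ ∈ B_{m−N}}`** — ★ p864380 `integral_piFourierSB_comp_linear_eq` at `G := 1_{B_N}`, whose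
transform is `μ^{ι₁}(B_N)·1_{B_{m−N}}` (★ `piFourierSB_indicator_piPrimePowBall`).  The left side is the mass of `B_N` for the inversion-normalised Haar measure of the
kernel hyperplane `ker Zᵀ` (chart-free); the right side computes it as a `ζ`-volume. [cite: WeilBNT1967, Chap. VII §2, Cor. 1] [cite: KudlaRallis1994, §2 (2.10)–(2.12)] -/
theorem fibreMass_box_eq (hA : ∀ (t : ι₁ → F) (ζ : κ → F), A t ⬝ᵥ Z ζ = resL eA t ⬝ᵥ ζ) (N : ℤ) :
    piSelfDualConst F κ (Measure.pi fun _ : κ => μ) m * (normAbs F (LinearMap.det (A : (ι₁ → F) →ₗ[F] (ι₁ → F))) : ℝ) *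
        (Measure.pi fun _ : ι₂ => μ).real {b : ι₂ → F | A (glue eA 0 b) ∈ piPrimePowBall F ι₁ N} =
      (Measure.pi fun _ : ι₁ => μ).real (piPrimePowBall F ι₁ N) *
        (Measure.pi fun _ : κ => μ).real {ζ : κ → F | Z ζ ∈ piPrimePowBall F ι₁ (m - N)} := by
  classical
  haveI : T2Space F := (isLocalField F).toT2Space
  haveI : SecondCountableTopology F := secondCountableTopology_localField F
  -- ★ (an-2) at the box indicator
  have key := K2LiuCornerZetaStageInversion.integral_piFourierSB_comp_linear_eq eA Z A μ hψ hm hA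
    (indicator_piPrimePowBall_mem_schwartzBruhat (F := F) (ι := ι₁) N (1 : ℂ))
  -- left side: the transform of the box indicator is `μ(B_N)·1_{B_{m−N}}`
  have hL : ∫ ζ, piFourierSB ψ (Measure.pi fun _ : ι₁ => μ) ((piPrimePowBall F ι₁ N).indicator fun _ => (1 : ℂ)) (Z ζ)
        ∂(Measure.pi fun _ : κ => μ) =
      ((Measure.pi fun _ : ι₁ => μ).real (piPrimePowBall F ι₁ N) : ℂ) *
        ((Measure.pi fun _ : κ => μ).real {ζ : κ → F | Z ζ ∈ piPrimePowBall F ι₁ (m - N)} : ℂ) := by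
    have hfun : (fun ζ : κ → F => piFourierSB ψ (Measure.pi fun _ : ι₁ => μ) ((piPrimePowBall F ι₁ N).indicator fun _ => (1 : ℂ)) (Z ζ)) =
        {ζ : κ → F | Z ζ ∈ piPrimePowBall F ι₁ (m - N)}.indicator
          (fun _ => ((Measure.pi fun _ : ι₁ => μ).real (piPrimePowBall F ι₁ N) : ℂ)) := by
      funext ζ
      rw [piFourierSB_indicator_piPrimePowBall (Measure.pi fun _ : ι₁ => μ) hm N (Z ζ)]
      by_cases hζ : Z ζ ∈ piPrimePowBall F ι₁ (m - N)
      · rw [if_pos hζ, indicator_of_mem (show ζ ∈ {ζ : κ → F | Z ζ ∈ piPrimePowBall F ι₁ (m - N)} from hζ)]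
      · rw [if_neg hζ, indicator_of_notMem (show ζ ∉ {ζ : κ → F | Z ζ ∈ piPrimePowBall F ι₁ (m - N)} from hζ)]
    rw [hfun, integral_indicator_const _ (isClosed_preimage_piPrimePowBall Z (m - N)).measurableSet, Complex.real_smul, mul_comm]
  -- right side: the integral of the indicator along the frame is the fibre mass
  have hR : ∫ b, (piPrimePowBall F ι₁ N).indicator (fun _ => (1 : ℂ)) (A (glue eA 0 b)) ∂(Measure.pi fun _ : ι₂ => μ) =
      ((Measure.pi fun _ : ι₂ => μ).real {b : ι₂ → F | A (glue eA 0 b) ∈ piPrimePowBall F ι₁ N} : ℂ) := by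
    have hfun : (fun b : ι₂ → F => (piPrimePowBall F ι₁ N).indicator (fun _ => (1 : ℂ)) (A (glue eA 0 b))) =
        {b : ι₂ → F | A (glue eA 0 b) ∈ piPrimePowBall F ι₁ N}.indicator (fun _ => (1 : ℂ)) := by
      funext b
      by_cases hb : A (glue eA 0 b) ∈ piPrimePowBall F ι₁ N
      · rw [indicator_of_mem hb, indicator_of_mem (show b ∈ {b : ι₂ → F | A (glue eA 0 b) ∈ piPrimePowBall F ι₁ N} from hb)]
      · rw [indicator_of_notMem hb, indicator_of_notMem (show b ∉ {b : ι₂ → F | A (glue eA 0 b) ∈ piPrimePowBall F ι₁ N} from hb)]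
    rw [hfun, integral_indicator_const _ (isClosed_preimage_frame_glue_piPrimePowBall eA A N).measurableSet, Complex.real_smul, mul_one]
  rw [hL, hR] at key
  -- compare in `ℂ`, then read off the reals
  have key' : (((Measure.pi fun _ : ι₁ => μ).real (piPrimePowBall F ι₁ N) *
        (Measure.pi fun _ : κ => μ).real {ζ : κ → F | Z ζ ∈ piPrimePowBall F ι₁ (m - N)} : ℝ) : ℂ) =
      ((piSelfDualConst F κ (Measure.pi fun _ : κ => μ) m * (normAbs F (LinearMap.det (A : (ι₁ → F) →ₗ[F] (ι₁ → F))) : ℝ) *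
        (Measure.pi fun _ : ι₂ => μ).real {b : ι₂ → F | A (glue eA 0 b) ∈ piPrimePowBall F ι₁ N} : ℝ) : ℂ) := by
    push_cast
    exact key
  exact_mod_cast key'.symm

/-! ## §2 The bound form: a lower bound on `Z` bounds the fibre mass -/

include hψ hm in
/-- **FIBRE MASS BOUND.**  If `Z ζ ∈ B_{m−N}` forces `ζ ∈ (𝔭^{n₁})^κ` (a LOWER BOUND on the linear map `Z`; for `Z_s ζ = ζ·s` this holds with
`μ^κ((𝔭^{n₁})^κ) ≍ ‖s‖^{−card κ}·μ^{ι₁}(B_N)⁻¹`-type scaling), then `c_κ · |det A| · μ^{ι₂}{b : A(0 ⊔ b) ∈ B_N} ≤ μ^{ι₁}(B_N) · μ^κ((𝔭^{n₁})^κ)`.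
[cite: WeilBNT1967, Chap. VII §2, Cor. 1] [cite: KudlaRallis1994, §2 (2.10)–(2.12)] -/
theorem fibreMass_box_le (hA : ∀ (t : ι₁ → F) (ζ : κ → F), A t ⬝ᵥ Z ζ = resL eA t ⬝ᵥ ζ) (N n₁ : ℤ)
    (hZ : ∀ ζ : κ → F, Z ζ ∈ piPrimePowBall F ι₁ (m - N) → ζ ∈ piPrimePowBall F κ n₁) :
    piSelfDualConst F κ (Measure.pi fun _ : κ => μ) m * (normAbs F (LinearMap.det (A : (ι₁ → F) →ₗ[F] (ι₁ → F))) : ℝ) *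
        (Measure.pi fun _ : ι₂ => μ).real {b : ι₂ → F | A (glue eA 0 b) ∈ piPrimePowBall F ι₁ N} ≤
      (Measure.pi fun _ : ι₁ => μ).real (piPrimePowBall F ι₁ N) * (Measure.pi fun _ : κ => μ).real (piPrimePowBall F κ n₁) := by
  haveI : T2Space F := (isLocalField F).toT2Space
  haveI : SecondCountableTopology F := secondCountableTopology_localField F
  rw [fibreMass_box_eq eA Z A μ hψ hm hA N]
  refine mul_le_mul_of_nonneg_left ?_ measureReal_nonneg
  exact measureReal_mono (fun ζ hζ => hZ ζ hζ) (measure_piPrimePowBall_lt_top _ n₁).ne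

/-! ## §3 Vertex summation against a measure with a vertex mass law -/

section Vertex

variable {ι : Type*} [Fintype ι] [Nonempty ι] (σ : Measure (ι → F))

/-- **VERTEX SUMMATION.**  `σ` ANY measure on `F^ι` not charging the origin, `f ≥ 0` measurable with the SHELL BOUND `f ≤ C_f·r^k` on
`(𝔭^{N₀+k})^ι ∖ (𝔭^{N₀+k+1})^ι` (`k ∈ ℕ`), and the VERTEX MASS LAW `σ((𝔭^{N₀+k})^ι) ≤ C_σ·ρ^k`: then `∫⁻_{(𝔭^{N₀})^ι} f dσ ≤ C_f·C_σ·Σ_k (r·ρ)^k` — the box minus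
the origin is the union of its shells (★ `SplitPlace.level`).  At use: `f` = the fibre mass `≍ q^{card κ · k}` of §2, `σ` = (an-1)'s null-cone measure with
`ρ = q^{−(card ι − 2)}`. [cite: Weil1965, Chap. III n° 37 Prop. 6] [cite: WeilBNT1967, Chap. VII §2, Cor. 1] -/
theorem setLIntegral_le_of_shell_bound (h0 : σ {0} = 0) (N₀ : ℤ) (f : (ι → F) → ℝ≥0∞)
    (Cf r Cσ ρ : ℝ≥0∞)
    (hf : ∀ (k : ℕ) (s : ι → F), s ∈ piPrimePowBall F ι (N₀ + k) → s ∉ piPrimePowBall F ι (N₀ + k + 1) → f s ≤ Cf * r ^ k)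
    (hσ : ∀ k : ℕ, σ (piPrimePowBall F ι (N₀ + k)) ≤ Cσ * ρ ^ k) :
    ∫⁻ s in piPrimePowBall F ι N₀, f s ∂σ ≤ Cf * Cσ * ∑' k : ℕ, (r * ρ) ^ k := by
  -- the box is the origin plus its shells
  have hcover : piPrimePowBall F ι N₀ ⊆ {0} ∪ ⋃ k : ℕ, (piPrimePowBall F ι (N₀ + k) \ piPrimePowBall F ι (N₀ + k + 1)) := by
    intro s hs
    by_cases hs0 : s = 0
    · exact Or.inl hs0
    · refine Or.inr (mem_iUnion.2 ⟨(Literature.NumberTheory.Weil1965.SplitPlace.level s - N₀).toNat, ?_⟩)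
      have hle := Literature.NumberTheory.Weil1965.SplitPlace.le_level_of_mem hs0 hs
      have hk : N₀ + ((Literature.NumberTheory.Weil1965.SplitPlace.level s - N₀).toNat : ℤ) = Literature.NumberTheory.Weil1965.SplitPlace.level s := by
        rw [Int.toNat_of_nonneg (sub_nonneg.2 hle)]; ring
      rw [hk]
      exact Literature.NumberTheory.Weil1965.SplitPlace.mem_shell_level hs0
  -- shell-wise estimate
  have hshell : ∀ k : ℕ, ∫⁻ s in piPrimePowBall F ι (N₀ + k) \ piPrimePowBall F ι (N₀ + k + 1), f s ∂σ ≤ Cf * Cσ * (r * ρ) ^ k := by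
    intro k
    calc ∫⁻ s in piPrimePowBall F ι (N₀ + k) \ piPrimePowBall F ι (N₀ + k + 1), f s ∂σ
        ≤ ∫⁻ _s in piPrimePowBall F ι (N₀ + k) \ piPrimePowBall F ι (N₀ + k + 1), Cf * r ^ k ∂σ :=
          setLIntegral_mono' ?_ fun s hs => hf k s hs.1 hs.2
      _ = Cf * r ^ k * σ (piPrimePowBall F ι (N₀ + k) \ piPrimePowBall F ι (N₀ + k + 1)) := setLIntegral_const _ _
      _ ≤ Cf * r ^ k * (Cσ * ρ ^ k) := by
          gcongr
          exact (measure_mono fun x hx => hx.1).trans (hσ k)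
      _ = Cf * Cσ * (r * ρ) ^ k := by rw [mul_pow]; ring
    exact (Literature.NumberTheory.Weil1965.SplitPlace.measurableSet_piPrimePowBall' (N₀ + k)).diff
      (Literature.NumberTheory.Weil1965.SplitPlace.measurableSet_piPrimePowBall' (N₀ + k + 1))
  calc ∫⁻ s in piPrimePowBall F ι N₀, f s ∂σ
      ≤ ∫⁻ s in {0} ∪ ⋃ k : ℕ, (piPrimePowBall F ι (N₀ + k) \ piPrimePowBall F ι (N₀ + k + 1)), f s ∂σ := lintegral_mono_set hcover
    _ ≤ (∫⁻ s in ({0} : Set (ι → F)), f s ∂σ) + ∫⁻ s in ⋃ k : ℕ, (piPrimePowBall F ι (N₀ + k) \ piPrimePowBall F ι (N₀ + k + 1)), f s ∂σ :=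
        lintegral_union_le _ _ _
    _ ≤ 0 + ∑' k : ℕ, ∫⁻ s in piPrimePowBall F ι (N₀ + k) \ piPrimePowBall F ι (N₀ + k + 1), f s ∂σ := by
        refine add_le_add ?_ (lintegral_iUnion_le _ _)
        rw [setLIntegral_measure_zero _ _ h0]
    _ ≤ 0 + ∑' k : ℕ, Cf * Cσ * (r * ρ) ^ k := by
        exact add_le_add le_rfl (ENNReal.tsum_le_tsum hshell)
    _ = Cf * Cσ * ∑' k : ℕ, (r * ρ) ^ k := by rw [zero_add, ENNReal.tsum_mul_left]

/-- **finiteness**: under the same letters with `C_f, C_σ < ∞` and `r·ρ < 1` the vertex integral is FINITE (geometric series ★ `ENNReal.tsum_geometric`).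
[cite: Weil1965, Chap. III n° 37 Prop. 6] -/
theorem setLIntegral_lt_top_of_shell_bound (h0 : σ {0} = 0) (N₀ : ℤ) (f : (ι → F) → ℝ≥0∞)
    {Cf r Cσ ρ : ℝ≥0∞} (hCf : Cf ≠ ∞) (hCσ : Cσ ≠ ∞) (hrρ : r * ρ < 1)
    (hf : ∀ (k : ℕ) (s : ι → F), s ∈ piPrimePowBall F ι (N₀ + k) → s ∉ piPrimePowBall F ι (N₀ + k + 1) → f s ≤ Cf * r ^ k)
    (hσ : ∀ k : ℕ, σ (piPrimePowBall F ι (N₀ + k)) ≤ Cσ * ρ ^ k) :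
    ∫⁻ s in piPrimePowBall F ι N₀, f s ∂σ < ∞ := by
  refine (setLIntegral_le_of_shell_bound σ h0 N₀ f Cf r Cσ ρ hf hσ).trans_lt ?_
  rw [ENNReal.tsum_geometric]
  refine ENNReal.mul_lt_top (ENNReal.mul_lt_top hCf.lt_top hCσ.lt_top) ?_
  exact ENNReal.inv_lt_top.2 (tsub_pos_iff_lt.2 hrρ)

end Vertex

/-! ## §4 Tonelli assembly: `G ∈ L¹(σ ⊗ ν)` from fibre bounds -/

section Tonelli

/-- **TONELLI ASSEMBLY.**  `σ`, `ν` s-finite; `G` a.e.-strongly measurable on `σ ⊗ ν` with FIBRE BOUNDS `∫⁻ ‖G(x,·)‖ dν ≤ W x` and `∫⁻ W dσ < ∞` ⇒ `G ∈ L¹(σ ⊗ ν)`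
(★ Mathlib `lintegral_prod`).  At use: `x = s` the cone variable, `W s` = the fibre mass of §2 times `sup |Θ|`, finite by §3. [cite: Weil1965, Chap. III n° 37 Prop. 6] -/
theorem integrable_prod_of_lintegral_fibre_le {X Y : Type*} [MeasurableSpace X] [MeasurableSpace Y] (σ : Measure X) (ν : Measure Y) [SFinite σ] [SFinite ν]
    {G : X × Y → ℂ} (hGm : AEStronglyMeasurable G (σ.prod ν)) (W : X → ℝ≥0∞) (hW : ∀ x, ∫⁻ y, ‖G (x, y)‖ₑ ∂ν ≤ W x)
    (hWint : ∫⁻ x, W x ∂σ < ∞) : Integrable G (σ.prod ν) := by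
  refine ⟨hGm, ?_⟩
  rw [HasFiniteIntegral, lintegral_prod _ hGm.enorm]
  exact (lintegral_mono hW).trans_lt hWint

end Tonelli

end Summit.HodgeConjecture.HodgeConjecture.Cruxes.HLiu418.K2LiuConeVertexFubini

end
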